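import Literature.Analysis.FluidPDE.DeRosaGluedTriple
import Literature.Analysis.FluidPDE.OnsagerBDSVGluedVelocity
import HarnessLib

/-!
# De Rosa's gluing stage, Prop. 5.5: the bounds (5.13)–(5.15) on the glued velocity

L. De Rosa, *Infinitely many Leray–Hopf solutions for the fractional Navier–Stokes equations*,
Comm. PDE 44 (2019) 335–365 = arXiv:1801.10235, §5.2, Prop. 5.5: "The velocity field `v̄_q` …
satisf[ies] (5.13) `‖v̄_q - v_ℓ‖_α ≲ δ_{q+1}^{1/2} ℓ^α`, (5.14) `‖v̄_q - v_ℓ‖_{N+α} ≲ τ_q δ_{q+1} ℓ^{-1-N+α}`,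
(5.15) `‖v̄_q‖_{1+N} ≲ δ_q^{1/2} λ_q ℓ^{-N}` … for all `N ≥ 0`", whose proof is "consequence of
Propositions 5.3 and 5.4 (the proof can be found in [BDLSV2017])" — i.e. BDSV Prop. 4.2
(`OnsagerBDSVGluedVelocity.lean`): `v̄ - v_ℓ` is at every time a convex combination
`χᵢ(vᵢ - v_ℓ) + (1-χᵢ)(vᵢ₊₁ - v_ℓ)` of two differences bounded by (5.10), and
`δ_{q+1}^{1/2} τ_q ℓ^{-1} ≤ λ_q^{-α/2} ≤ 1` converts (5.10) at `N = 0` into (5.13).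

For the glued velocity `BDSV.gluedVel` of a `DeRosa.IsGlueFamily` (`DeRosaGluedTriple.lean`) whose
members obey the stability bounds (5.10) in the form `BDSV.StabilityBounds` (constant `C₃`, orders
`≤ N̄`, on the life spans `S_j`), this file proves, with the explicit constants of the BDSV file:

* `DeRosa.IsGlueFamily.exists_convex_decomp` — `v̄(t) = θu_j(t) + (1-θ)u_j'(t)`, `θ ∈ [0,1]`;
* `DeRosa.IsGlueFamily.holderSupLE_gluedVel_sub` — **(5.14)**:
  `‖v̄ - v_ℓ‖_{N+α} ≤ |C₃| τ_q δ_{q+1} ℓ^{-N-1+α}` on `[0,T]`, `N ≤ N̄`;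
* `DeRosa.IsGlueFamily.supLE_gluedVel_sub` — **(5.13)** at order zero:
  `|v̄ - v_ℓ| ≤ |C₃| δ_{q+1}^{1/2} ℓ^α` (the clause of `DeRosa.gluingStage`);
* `DeRosa.IsGlueFamily.holderSupLE_gluedVel` — **(5.15)**:
  `‖v̄‖_{N+1} ≤ (|C_N| + 3|C₃|) δ_q^{1/2} λ_q ℓ^{-N}` for `N + 1 ≤ N̄`, given (5.6) for `v_ℓ`.

The proofs are those of the BDSV file (`BDSV.eContDiffHolderNorm_convex_comb_le`,
`BDSV.glueScale_mul_amp_succ_mul_rpow_le_sqrt`, `BDSV.glueScale_mul_amp_succ_mul_rpow_le`) for the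
De Rosa family.

## References

* L. De Rosa, Comm. PDE 44 (2019) = arXiv:1801.10235, §5.2 Prop. 5.5 ((5.13)–(5.15)), Prop. 5.3
  (5.10), (5.7). [`Derosa2018`]
* T. Buckmaster, C. De Lellis, L. Székelyhidi Jr., V. Vicol, CPAM 72 (2019) = arXiv:1701.08678,
  §4.3 Prop. 4.2 ((4.4)–(4.6)). [`BuckmasterEtAl2018`]
-/

noncomputable section

open MeasureTheory Set Filter Topology Function
open scoped NNReal ENNReal ContDiff

namespace Literature.Analysis.FluidPDE

namespace DeRosa

open FunctionSpaces FunctionSpaces.Torus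
open BDSV hiding IsGlueFamily

section GluedVelocity

variable {γ ν β α a b T C₃ : ℝ} {q n Nb : ℕ} {vℓ : ℝ → UnitAddTorus (Fin 3) → EuclideanSpace ℝ (Fin 3)} {pℓ : ℝ → UnitAddTorus (Fin 3) → ℝ}
  {Rℓ : ℝ → UnitAddTorus (Fin 3) → Fin 3 → EuclideanSpace ℝ (Fin 3)} {v : ℕ → ℝ → UnitAddTorus (Fin 3) → EuclideanSpace ℝ (Fin 3)} {p : ℕ → ℝ → UnitAddTorus (Fin 3) → ℝ} {Cin : ℕ → ℝ}

/-- **The convex decomposition of `v̄`**: at every `t ∈ [0,T]` there are `i, i' ≤ n` and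
`θ ∈ [0,1]` with `t` in the life spans `Sᵢ`, `Sᵢ'` and `v̄(t) = θ uᵢ(t) + (1 - θ) uᵢ'(t)`
(`θ = χᵢ(t)`, `i' = i + 1` on `[tᵢ, tᵢ + τ]` for `i < n`; `v̄ = u_n` past `t_n`) (De Rosa p. 13:
"`v̄_q = χᵢvᵢ + (1 - χᵢ)vᵢ₊₁`"). [cite: Derosa2018, §5.2 (p. 13)] -/
theorem IsGlueFamily.exists_convex_decomp {τ : ℝ} (h : IsGlueFamily γ ν T τ n vℓ pℓ Rℓ v p) {t : ℝ}
    (htT : t ∈ Icc 0 T) :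
    ∃ i i' : ℕ, ∃ θ : ℝ, i ≤ n ∧ i' ≤ n ∧ θ ∈ Icc (0 : ℝ) 1 ∧
      t ∈ glueInterval T τ i ∧ t ∈ glueInterval T τ i' ∧
      ∀ x, gluedVel τ n v t x = θ • v i t x + (1 - θ) • v i' t x := by
  obtain ⟨i, hin, ht⟩ := h.exists_anchor htT
  rcases lt_or_eq_of_le hin with hi | rfl
  · exact ⟨i, i + 1, upperStep τ n i t, hin, Nat.succ_le_of_lt hi, upperStep_mem_Icc τ n i t,
      h.Icc_inter_subset_glueInterval i ⟨ht, htT⟩, h.Icc_inter_subset_glueInterval_succ i ⟨ht, htT⟩,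
      fun x => h.gluedVel_apply hin ht x⟩
  · refine ⟨i, i, 1, le_rfl, le_rfl, ⟨zero_le_one, le_rfl⟩, h.Icc_inter_subset_glueInterval i ⟨ht, htT⟩,
      h.Icc_inter_subset_glueInterval i ⟨ht, htT⟩, fun x => ?_⟩
    rw [h.gluedVel_apply_last ht x, one_smul, sub_self, zero_smul, add_zero]

/-- **(5.14)** (`= (3.12)/(5.10)` transported to the glued velocity):
`‖v̄ - v_ℓ‖_{N+α} ≤ |C₃| τ_q δ_{q+1} ℓ^{-N-1+α}` on `[0,T]` for `N ≤ N̄`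
(`v̄ - v_ℓ = θ(uᵢ - v_ℓ) + (1-θ)(uᵢ' - v_ℓ)` and (5.10) for both). [cite: Derosa2018, §5.2 Prop. 5.5 (5.14)] -/
theorem IsGlueFamily.holderSupLE_gluedVel_sub (h : IsGlueFamily γ ν T (glueScale β α a b q) n vℓ pℓ Rℓ v p)
    (hS : ∀ i : ℕ, i ≤ n → StabilityBounds β α a b T C₃ q Nb i vℓ pℓ (v i) (p i)) (ha : 1 ≤ a)
    {N : ℕ} (hN : N ≤ Nb) :
    HolderSupLE T (fun t x => gluedVel (glueScale β α a b q) n v t x - vℓ t x) N (Real.toNNReal α)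
      (|C₃| * (glueScale β α a b q * amp β a b (q + 1) * mollScale β α a b q ^ (-(N : ℝ) - 1 + α))) := by
  intro t htT
  obtain ⟨i, i', θ, hi, hi', hθ, hti, hti', hdec⟩ := h.exists_convex_decomp htT
  set τ := glueScale β α a b q with hτ
  set X := τ * amp β a b (q + 1) * mollScale β α a b q ^ (-(N : ℝ) - 1 + α) with hX
  have hX0 : 0 ≤ X := by
    have h1 := h.hτ
    have h2 := amp_pos (β := β) (b := b) ha (q + 1)
    have h3 := mollScale_pos (β := β) (α := α) (b := b) ha q
    positivity
  have hmono : ENNReal.ofReal (C₃ * X) ≤ ENNReal.ofReal (|C₃| * X) :=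
    ENNReal.ofReal_le_ofReal (mul_le_mul_of_nonneg_right (le_abs_self _) hX0)
  have hf := ((hS i hi).velocity_sub N hN t hti).trans hmono
  have hg := ((hS i' hi').velocity_sub N hN t hti').trans hmono
  have hvℓ := h.isSmooth_vℓ htT
  have hfs : IsContDiff N (fun x => v i t x - vℓ t x) :=
    ((h.isSmooth_v hi hti).sub hvℓ).isContDiff (mod_cast le_top)
  have hgs : IsContDiff N (fun x => v i' t x - vℓ t x) :=
    ((h.isSmooth_v hi' hti').sub hvℓ).isContDiff (mod_cast le_top)
  have hfun : (fun x => gluedVel τ n v t x - vℓ t x) =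
      fun x => θ • (v i t x - vℓ t x) + (1 - θ) • (v i' t x - vℓ t x) := by
    funext x
    rw [hdec x]
    simp only [smul_sub, sub_smul, one_smul]
    abel
  show FunctionSpaces.Torus.eContDiffHolderNorm N (Real.toNNReal α) (fun x => gluedVel τ n v t x - vℓ t x) ≤ _
  rw [hfun]
  exact eContDiffHolderNorm_convex_comb_le hfs hgs hθ hf hg

/-- **(5.13)** at order zero (the clause `‖v̄_q - v_ℓ‖₀ ≤ C δ_{q+1}^{1/2} ℓ^α` of
`DeRosa.gluingStage`): `|v̄(t,x) - v_ℓ(t,x)| ≤ |C₃| δ_{q+1}^{1/2} ℓ^α` on `[0,T] × 𝕋³` (from the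
`N = 0` case of `holderSupLE_gluedVel_sub` and `δ_{q+1}^{1/2} τ_q ℓ^{-1} ≤ λ_q^{-α/2} ≤ 1`).
[cite: Derosa2018, §5.2 Prop. 5.5 (5.13)] -/
theorem IsGlueFamily.supLE_gluedVel_sub (h : IsGlueFamily γ ν T (glueScale β α a b q) n vℓ pℓ Rℓ v p)
    (hS : ∀ i : ℕ, i ≤ n → StabilityBounds β α a b T C₃ q Nb i vℓ pℓ (v i) (p i)) (ha : 1 ≤ a)
    (hb : 1 ≤ b) (hβ : 0 ≤ β) (hα : 0 ≤ α) :
    SupLE T (fun t x => gluedVel (glueScale β α a b q) n v t x - vℓ t x)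
      (|C₃| * (Real.sqrt (amp β a b (q + 1)) * mollScale β α a b q ^ α)) := by
  intro t htT x
  have hH := h.holderSupLE_gluedVel_sub hS ha (Nat.zero_le Nb) t htT
  have hpt := (Torus.enorm_le_eContDiffHolderNorm 0 (Real.toNNReal α)
    (fun y => gluedVel (glueScale β α a b q) n v t y - vℓ t y) x).trans hH
  have hB : 0 ≤ |C₃| * (Real.sqrt (amp β a b (q + 1)) * mollScale β α a b q ^ α) := by
    have := mollScale_pos (β := β) (α := α) (b := b) ha q
    positivity
  rw [← ofReal_norm] at hpt
  have hle : |C₃| * (glueScale β α a b q * amp β a b (q + 1) * mollScale β α a b q ^ (-((0 : ℕ) : ℝ) - 1 + α)) ≤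
      |C₃| * (Real.sqrt (amp β a b (q + 1)) * mollScale β α a b q ^ α) := by
    rw [Nat.cast_zero, neg_zero, zero_sub]
    exact mul_le_mul_of_nonneg_left (glueScale_mul_amp_succ_mul_rpow_le_sqrt ha hb hβ hα q) (abs_nonneg _)
  exact (ENNReal.ofReal_le_ofReal_iff hB).1 (hpt.trans (ENNReal.ofReal_le_ofReal hle))

/-- **(5.15)**: `‖v̄(t)‖_{N+1} ≤ (|C_N| + 3|C₃|) δ_q^{1/2} λ_q ℓ^{-N}` on `[0,T]` for `N + 1 ≤ N̄`,
from (5.6) for `v_ℓ` and `‖v̄ - v_ℓ‖_{N+1} ≤ 3‖v̄ - v_ℓ‖_{N+1+α} ≤ 3|C₃|τ_qδ_{q+1}ℓ^{-N-2+α} ≤ 3|C₃|δ_q^{1/2}λ_qℓ^{-N}`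
(De Rosa: "`‖v̄_q‖_{1+N} ≲ δ_q^{1/2}λ_qℓ^{-N}`", BDSV (4.5)). [cite: Derosa2018, §5.2 Prop. 5.5 (5.15)] -/
theorem IsGlueFamily.holderSupLE_gluedVel (h : IsGlueFamily γ ν T (glueScale β α a b q) n vℓ pℓ Rℓ v p)
    (hS : ∀ i : ℕ, i ≤ n → StabilityBounds β α a b T C₃ q Nb i vℓ pℓ (v i) (p i)) (ha : 1 ≤ a)
    (hb : 1 ≤ b) (hβ : 0 ≤ β) (hα : 0 ≤ α)
    (h213 : ∀ N : ℕ, HolderSupLE T vℓ (N + 1) 0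
      (Cin N * (Real.sqrt (amp β a b q) * freq a b q * mollScale β α a b q ^ (-(N : ℝ)))))
    {N : ℕ} (hN : N + 1 ≤ Nb) :
    HolderSupLE T (gluedVel (glueScale β α a b q) n v) (N + 1) 0
      ((|Cin N| + 3 * |C₃|) * (Real.sqrt (amp β a b q) * freq a b q * mollScale β α a b q ^ (-(N : ℝ)))) := by
  intro t htT
  set τ := glueScale β α a b q with hτ
  set Y := Real.sqrt (amp β a b q) * freq a b q * mollScale β α a b q ^ (-(N : ℝ)) with hY
  have hY0 : 0 ≤ Y := by
    have h1 := amp_pos (β := β) (b := b) ha q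
    have h2 := freq_pos (b := b) ha q
    have h3 := mollScale_pos (β := β) (α := α) (b := b) ha q
    positivity
  have hvℓ : FunctionSpaces.Torus.eContDiffHolderNorm (N + 1) 0 (vℓ t) ≤ ENNReal.ofReal (|Cin N| * Y) :=
    (h213 N t htT).trans (ENNReal.ofReal_le_ofReal (mul_le_mul_of_nonneg_right (le_abs_self _) hY0))
  have hdiff := h.holderSupLE_gluedVel_sub hS ha hN t htT
  have hpar : τ * amp β a b (q + 1) * mollScale β α a b q ^ (-((N + 1 : ℕ) : ℝ) - 1 + α) ≤ Y := by
    have := glueScale_mul_amp_succ_mul_rpow_le ha hb hβ hα q (N : ℝ)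
    rwa [show (-((N + 1 : ℕ) : ℝ) - 1 + α) = -(N : ℝ) - 2 + α by push_cast; ring]
  have hdiff0 : FunctionSpaces.Torus.eContDiffHolderNorm (N + 1) 0 (fun x => gluedVel τ n v t x - vℓ t x) ≤
      ENNReal.ofReal (3 * |C₃| * Y) :=
    calc FunctionSpaces.Torus.eContDiffHolderNorm (N + 1) 0 (fun x => gluedVel τ n v t x - vℓ t x)
        ≤ 3 * FunctionSpaces.Torus.eContDiffHolderNorm (N + 1) (Real.toNNReal α) (fun x => gluedVel τ n v t x - vℓ t x) :=
          Torus.eContDiffHolderNorm_exponent_zero_le _ _ _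
      _ ≤ 3 * ENNReal.ofReal (|C₃| * (τ * amp β a b (q + 1) * mollScale β α a b q ^ (-((N + 1 : ℕ) : ℝ) - 1 + α))) := by
          gcongr
      _ ≤ 3 * ENNReal.ofReal (|C₃| * Y) := by gcongr
      _ = ENNReal.ofReal (3 * |C₃| * Y) := by
          rw [mul_assoc (3 : ℝ), ENNReal.ofReal_mul (by norm_num : (0 : ℝ) ≤ 3), ENNReal.ofReal_ofNat]
  have hvℓs : IsContDiff (N + 1 : ℕ) (vℓ t) := (h.isSmooth_vℓ htT).isContDiff (mod_cast le_top)
  have hds : IsContDiff (N + 1 : ℕ) (fun x => gluedVel τ n v t x - vℓ t x) :=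
    ((h.smooth_gluedVel.isSmooth_slice htT).sub (h.isSmooth_vℓ htT)).isContDiff (mod_cast le_top)
  have hfun : gluedVel τ n v t = vℓ t + fun x => gluedVel τ n v t x - vℓ t x := by
    funext x; simp
  rw [hfun]
  calc FunctionSpaces.Torus.eContDiffHolderNorm (N + 1) 0 (vℓ t + fun x => gluedVel τ n v t x - vℓ t x)
      ≤ FunctionSpaces.Torus.eContDiffHolderNorm (N + 1) 0 (vℓ t) +
          FunctionSpaces.Torus.eContDiffHolderNorm (N + 1) 0 (fun x => gluedVel τ n v t x - vℓ t x) :=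
        Torus.eContDiffHolderNorm_add_le hvℓs hds
    _ ≤ ENNReal.ofReal (|Cin N| * Y) + ENNReal.ofReal (3 * |C₃| * Y) := add_le_add hvℓ hdiff0
    _ = ENNReal.ofReal ((|Cin N| + 3 * |C₃|) * Y) := by
        rw [← ENNReal.ofReal_add (by positivity) (by positivity)]; ring_nf

end GluedVelocity

end DeRosa

end Literature.Analysis.FluidPDE
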